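import Summits.MatrixMultiplication.MatrixMultiplication.Theses.ModularHeisenberg
import Literature.Computability.AlgebraicComplexity.AsymptoticRankAlgebraicExtension

/-!
# Crux `CharacteristicLift` (stmt-MatrixMultiplication-4348) — `Lines/birth.lean`, the BC3 birth skeleton

Route `ModularHeisenberg` (route-MatrixMultiplication-ModularHeisenberg; `closes : HeisenbergLowerFrame →
CharacteristicLift → ModularHeisenbergMinimal → MatrixMultiplication`, proved in the route file).  The crux,
with `T_p^R` the multiplication table of the Heisenberg group `H_p = U₃(ℤ/p)` written with entries `0, 1`
in a commutative semiring `R` (below: `heis R p`, an `abbrev` that is the route's inline term character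
for character, so every bridge is definitional):

  `CharacteristicLift : ∀ p prime, R̃(T_p^ℂ) ≤ R̃(T_p^{𝔽̄_p})`
  (characteristic transfer of asymptotic rank for the one integer tensor `T_p`).

## The line: characteristic-zero descent + p-adic (Hensel) integral lifting

The route header's own mechanism for this crux ("near-optimal `𝔽̄_p`-decompositions of `T_p^{⊗n}` …
lift to Witt vectors `W(𝔽̄_p)` ⊂ an algebraically closed field of characteristic `0`, and `R̃` over all
such fields agrees with `R̃_ℂ`"; TWO-LAYER PLAN `CharacteristicLift ⇐ HenselUnobstructed → WittToComplex`)
made kernel-checked as a chain of five comparisons of `R̃(T_p^R)` along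

  `ℂ  =  ℚ  =  ℚ_p  ≤  ℤ_p  ≤  𝔽_p  =  𝔽̄_p`
      (a)   (b)    (c)    (d)    (e)

where (a) `asymptoticRank_ratCast` (BCS Cor. 15.18 for `ℂ/ℚ`, PROVED in the tree), (c) extension of
scalars along `ℤ_p → ℚ_p` never increases rank (`asymptoticRank_ringHom_le`, proved below for
semirings) and (e) `asymptoticRank_algebraicClosure` (PROVED in the tree) are sorry-free, and the two
`sorry`s of the file are exactly the two remaining arrows:

* `stub_charZeroDescent` — **(b), characteristic-zero descent** (BCS Prop. 15.17(1)/Cor. 15.18 for an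
  ARBITRARY field `L` of characteristic `0`, here used at `L = ℚ_p`): for every rational 3-tensor `t`,
  `R̃_L(t_L) = R̃_ℚ(t)`.  The tree proves the cases `L = ℂ` (`asymptoticRank_ratCast`, Nullstellensatz
  step `exists_numberField_decomposition`) and `L/K` algebraic (`asymptoticRank_algebraMap_of_isAlgebraic`);
  the general case is the same Nullstellensatz/Zariski argument with `ℂ` replaced by `L` (the f.g.
  `ℚ`-subalgebra of `L` generated by the coordinates of a decomposition has a maximal ideal with residue
  field a number field; descend with the `d³` loss `tensorRank_le_of_eq_sum_algebraMap`; kill `d³` in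
  powers).  Size M, PROVABLE NOW; load-bearing (it is what lets the p-adic world stand in for `ℂ`: the
  "WittToComplex" half of the route's plan, with `W(𝔽_p) = ℤ_p`).
* `stub_henselLift` — **(d), p-adic integral lifting** (the engine; "HenselUnobstructed" in asymptotic
  form): for every prime `p`, `R̃_{ℤ_p}(T_p^{ℤ_p}) ≤ R̃_{𝔽_p}(T_p^{𝔽_p})` — the asymptotic rank of the
  INTEGRAL p-adic Heisenberg table is already attained modulo `p` (reduction mod `p` gives `≥` for free,
  `asymptoticRank_ringHom_le` along `PadicInt.toZMod`, so (d) says `=`).  This is the crux TRANSFERRED to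
  the statement Hensel lifting actually proves, and it is STRICTLY STRONGER than the crux (it also denies
  an integrality gap `R̃_{ℤ_p} > R̃_{ℚ_p}` for `T_p`): a near-optimal `𝔽_p`-decomposition of `T_p^{⊗N}`
  (which exists for large `N` by (e)) is an `𝔽_p`-point of the Brent scheme of `T_p^{⊗N}` over `ℤ_p`;
  where that point is unobstructed (smooth, or made so by `p^{o(N)}` padding — the route's bet) it lifts
  to a `ℤ_p`-point by Hensel's lemma / Tougeron's implicit function theorem (`ℤ_p` is Henselian:
  Mathlib `hensels_lemma`, `HenselianLocalRing`).  Why easier than the crux as filed: no transcendental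
  field, no `𝔽̄_p`; one complete DVR and its residue field, and the comparison map is literally reduction
  of `ℤ_p`-points of one explicit scheme.  Size XL / open-problem (why it might fail, inherited: finite-
  level lifting of a GIVEN scheme fails — Kauers–Moosbauer arXiv:2212.01175 §5, a rank-47 `𝔽₂`-scheme of
  `⟨4,4,4⟩` with no `ℤ/4`-lift — so padding/re-choice of the scheme is essential; and an integrality gap
  for `T_p` would kill (d) while leaving the crux open).
* `CharacteristicLift_of : <stub₁-sig> → <stub₂-sig> → CharacteristicLift` — THE skeleton theorem, the
  crux BY NAME from the two stub statements as hypotheses (sorry-free, standard axioms), and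
  `CharacteristicLift_of_stubs : CharacteristicLift` — the same fed with the two declared stubs (closed
  only through their `sorry`s).

Honest status.  Given stub 1 (true, provable now) and the tree, stub 2 IMPLIES the crux and is implied by
nothing known; it is not equivalent to the crux (it is stronger by the integrality clause), and neither
stub is cheaply the crux or the summit (BC3 probes, `Lines/birth.md`).  The refuters' standing remark
(item notes g43-27 / ATTACK.md: `ω(ℂ) = 2 ⇒ CharacteristicLift`, and modulo `ModularHeisenbergMinimal`
the crux is summit-equivalent) is untouched by this skeleton and is inherited by stub 2.
Disproof used: none exists (`ledger crux ls stmt-MatrixMultiplication-4348`: no workfiles, no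
`Disproof.lean`, no `Negative/` lemma; `ledger negatives --problem MatrixMultiplication` = 7 entries
(2026-08-17), none about characteristic transfer / `ZMod` / p-adics), so no `_false_without_` obligation
applies.

BC3 probes (planner-run, `lean check`, each `first | exact? | simpa [X] | (unfold X; simpa) | aesop` under
`maxHeartbeats 400000`): `stub_charZeroDescent → CharacteristicLift`, `stub_charZeroDescent →
MatrixMultiplication`, `stub_henselLift → CharacteristicLift`, `stub_henselLift → MatrixMultiplication` —
all FAIL (files `bc/probe_*.lean` in the planner folder; verdicts quoted in `Lines/birth.md`).
-/

-- `Summit.<Summit>.<Problem>`: for the single-conjunct summit the duplicate component is mandated.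
set_option linter.dupNamespace false

noncomputable section

namespace Summit.MatrixMultiplication.MatrixMultiplication.Cruxes.CharacteristicLift.Birth

open scoped BigOperators
open Literature.Computability.AlgebraicComplexity

/-! ## The two registered stubs -/

/-- **Stub 1 — characteristic-zero descent of asymptotic rank** (BCS Prop. 15.17(1) with the limit
argument of Cor. 15.18, Schönhage, for `R̃` of a 3-tensor, over an ARBITRARY field of characteristic
`0`): for every field `L` with `CharZero L` and every rational tensor `t`, the asymptotic rank of the
scalar extension `t_L` equals the asymptotic rank of `t` over `ℚ`.  `≤` is extension of scalars
(`asymptoticRank_map_le (Rat.castHom L)`); `≥` is the Nullstellensatz/Zariski descent of a decomposition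
of a power to a number field followed by restriction of scalars with a `d³` loss, killed in powers —
verbatim the tree's proof of `asymptoticRank_ratCast` with `ℂ` replaced by `L`.  Used at `L = ℚ_[p]`.
Size M, provable now.  Sources: BurgisserClausenShokrollahi1997 (§15.3, Prop. 15.17, Cor. 15.18),
Pratt2024SCC (§1.1), AlmanLi2026 (proof of Cor. 4.1). -/
theorem stub_charZeroDescent :
    ∀ (L : Type) [Field L] [CharZero L] (ι κ μ : Type) [Fintype ι] [Fintype κ] [Fintype μ]
      (t : ι → κ → μ → ℚ),
      Literature.Computability.AlgebraicComplexity.asymptoticRank (fun a b c => ((t a b c : ℚ) : L)) =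
        Literature.Computability.AlgebraicComplexity.asymptoticRank t := by
  sorry

/-- **Stub 2 — p-adic integral (Hensel) lifting for the Heisenberg table** (the engine): for every
prime `p`, the asymptotic rank over the `p`-adic INTEGERS `ℤ_[p]` of the `0/1` Heisenberg table `T_p`
(`(a,b,c)·(a',b',c') = (a+a', b+b', c+c'+ab')` on `(Fin p)³`) is at most its asymptotic rank over the
residue field `ZMod p` (hence equal to it: reduction mod `p` gives the other inequality).  The statement
Hensel lifting of near-optimal `𝔽_p`-decompositions of the powers `T_p^{⊗N}` to `ℤ_p` would prove;
strictly stronger than the crux (no integrality gap for `T_p`).  Size XL / open-problem.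
Sources: arXiv:2212.01175 (§5, finite-level lifting obstructions), BurgisserClausenShokrollahi1997
(Problem 15.5, Cor. 15.18), arXiv:2602.13171, ChristandlVranaZuiddam2023. -/
theorem stub_henselLift :
    ∀ (p : ℕ) [Fact p.Prime],
      Literature.Computability.AlgebraicComplexity.asymptoticRank
          (fun z x y : Fin p × Fin p × Fin p =>
            if x.1 + y.1 = z.1 ∧ x.2.1 + y.2.1 = z.2.1 ∧ x.2.2 + y.2.2 + x.1 * y.2.1 = z.2.2
            then (1 : ℤ_[p]) else 0) ≤
        Literature.Computability.AlgebraicComplexity.asymptoticRank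
          (fun z x y : Fin p × Fin p × Fin p =>
            if x.1 + y.1 = z.1 ∧ x.2.1 + y.2.1 = z.2.1 ∧ x.2.2 + y.2.2 + x.1 * y.2.1 = z.2.2
            then (1 : ZMod p) else 0) := by
  sorry

/-! ## Sorry-free core -/

/-- The route's inline Heisenberg table with entries `0, 1` in an arbitrary type with `0` and `1`
(an `abbrev`: `heis ℂ p` and `heis (AlgebraicClosure (ZMod p)) p` are the two sides of the crux
definitionally, `heis ℤ_[p] p` / `heis (ZMod p) p` the two sides of stub 2). [folklore] -/
abbrev heis (R : Type*) [Zero R] [One R] (p : ℕ) :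
    Fin p × Fin p × Fin p → Fin p × Fin p × Fin p → Fin p × Fin p × Fin p → R :=
  fun z x y =>
    if x.1 + y.1 = z.1 ∧ x.2.1 + y.2.1 = z.2.1 ∧ x.2.2 + y.2.2 + x.1 * y.2.1 = z.2.2
    then (1 : R) else 0

/-- A `0/1` table commutes with every ring homomorphism: `f ∘ T_p^R = T_p^S`. [folklore] -/
theorem heis_map {R S : Type*} [Semiring R] [Semiring S] (f : R →+* S) (p : ℕ) :
    (fun z x y => f (heis R p z x y)) = heis S p := by
  funext z x y
  simp only [heis]
  split_ifs <;> simp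

/-- A `0/1` table commutes with the rational cast: `(T_p^ℚ)_L = T_p^L`. [folklore] -/
theorem heis_ratCast (L : Type*) [DivisionRing L] [CharZero L] (p : ℕ) :
    (fun z x y => ((heis ℚ p z x y : ℚ) : L)) = heis L p := by
  funext z x y
  simp only [heis]
  split_ifs <;> simp

/-- **Extension of scalars along a (semi)ring homomorphism never increases the asymptotic rank**:
`R̃_L(f ∘ t) ≤ R̃_K(t)` for `f : K →+* L` between commutative SEMIRINGS (termwise
`R_L((f∘t)^{⊗N}) = R_L(f ∘ t^{⊗N}) ≤ R_K(t^{⊗N})`, `tensorRank_map_le`).  The tree's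
`asymptoticRank_map_le` is the same statement for fields; the ring `ℤ_[p]` needs this form.
[cite: BurgisserClausenShokrollahi1997, §15.3 (15.14)] -/
theorem asymptoticRank_ringHom_le {K L : Type*} [CommSemiring K] [CommSemiring L]
    {ι κ μ : Type*} [Fintype ι] [Fintype κ] [Fintype μ] (f : K →+* L) (t : ι → κ → μ → K) :
    asymptoticRank (fun a b c => f (t a b c)) ≤ asymptoticRank t := by
  unfold asymptoticRank
  have hbdd : BddBelow (Set.range fun N : ℕ =>
      ((tensorRank (kroneckerPow (fun a b c => f (t a b c)) (N + 1)) : ℝ) ^ ((N : ℝ) + 1)⁻¹)) :=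
    ⟨0, by rintro _ ⟨N, rfl⟩; positivity⟩
  refine le_ciInf fun N => (ciInf_le hbdd N).trans ?_
  have hmap : kroneckerPow (fun a b c => f (t a b c)) (N + 1) =
      fun a b c => f (kroneckerPow t (N + 1) a b c) := by
    funext a b c
    simp only [kroneckerPow_apply, map_prod]
  have hle : (tensorRank (kroneckerPow (fun a b c => f (t a b c)) (N + 1)) : ℝ) ≤
      tensorRank (kroneckerPow t (N + 1)) := by
    rw [hmap]
    exact_mod_cast tensorRank_map_le f (kroneckerPow t (N + 1))
  exact Real.rpow_le_rpow (Nat.cast_nonneg _) hle (by positivity)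

/-! ## The composition: the two stub statements prove the crux BY NAME -/

/-- **THE SKELETON THEOREM.** The crux
`Summit.MatrixMultiplication.MatrixMultiplication.Theses.ModularHeisenberg.CharacteristicLift`
(stmt-MatrixMultiplication-4348) from the two stub STATEMENTS as hypotheses, along the chain
`R̃(T_p^ℂ) = R̃(T_p^ℚ)` (`asymptoticRank_ratCast`, proved) `= R̃(T_p^{ℚ_p})` (stub 1 at `L = ℚ_[p]`)
`≤ R̃(T_p^{ℤ_p})` (`asymptoticRank_ringHom_le` along `ℤ_[p] → ℚ_[p]`) `≤ R̃(T_p^{𝔽_p})` (stub 2)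
`= R̃(T_p^{𝔽̄_p})` (`asymptoticRank_algebraicClosure`, proved).  Sorry-free; standard axioms. [folklore] -/
theorem CharacteristicLift_of :
    (∀ (L : Type) [Field L] [CharZero L] (ι κ μ : Type) [Fintype ι] [Fintype κ] [Fintype μ]
      (t : ι → κ → μ → ℚ),
      Literature.Computability.AlgebraicComplexity.asymptoticRank (fun a b c => ((t a b c : ℚ) : L)) =
        Literature.Computability.AlgebraicComplexity.asymptoticRank t) →
    (∀ (p : ℕ) [Fact p.Prime],
      Literature.Computability.AlgebraicComplexity.asymptoticRank
          (fun z x y : Fin p × Fin p × Fin p =>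
            if x.1 + y.1 = z.1 ∧ x.2.1 + y.2.1 = z.2.1 ∧ x.2.2 + y.2.2 + x.1 * y.2.1 = z.2.2
            then (1 : ℤ_[p]) else 0) ≤
        Literature.Computability.AlgebraicComplexity.asymptoticRank
          (fun z x y : Fin p × Fin p × Fin p =>
            if x.1 + y.1 = z.1 ∧ x.2.1 + y.2.1 = z.2.1 ∧ x.2.2 + y.2.2 + x.1 * y.2.1 = z.2.2
            then (1 : ZMod p) else 0)) →
    Summit.MatrixMultiplication.MatrixMultiplication.Theses.ModularHeisenberg.CharacteristicLift := by
  intro h0 hH p hp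
  show asymptoticRank (heis ℂ p) ≤ asymptoticRank (heis (AlgebraicClosure (ZMod p)) p)
  calc asymptoticRank (heis ℂ p)
      = asymptoticRank (fun z x y => ((heis ℚ p z x y : ℚ) : ℂ)) := by rw [heis_ratCast ℂ p]
    _ = asymptoticRank (heis ℚ p) := asymptoticRank_ratCast _
    _ = asymptoticRank (fun z x y => ((heis ℚ p z x y : ℚ) : ℚ_[p])) := (h0 ℚ_[p] _ _ _ _).symm
    _ = asymptoticRank (heis ℚ_[p] p) := by rw [heis_ratCast ℚ_[p] p]
    _ = asymptoticRank (fun z x y => PadicInt.Coe.ringHom (heis ℤ_[p] p z x y)) := by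
        rw [heis_map (PadicInt.Coe.ringHom (p := p)) p]
    _ ≤ asymptoticRank (heis ℤ_[p] p) := asymptoticRank_ringHom_le _ _
    _ ≤ asymptoticRank (heis (ZMod p) p) := hH p
    _ = asymptoticRank (fun z x y => algebraMap (ZMod p) (AlgebraicClosure (ZMod p))
          (heis (ZMod p) p z x y)) := (asymptoticRank_algebraicClosure _).symm
    _ = asymptoticRank (heis (AlgebraicClosure (ZMod p)) p) := by
        rw [heis_map (algebraMap (ZMod p) (AlgebraicClosure (ZMod p))) p]

/-- The crux fed with the two DECLARED stubs (closed only through their `sorry`s; this is the shape the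
line's provers discharge stub by stub). [folklore] -/
theorem CharacteristicLift_of_stubs :
    Summit.MatrixMultiplication.MatrixMultiplication.Theses.ModularHeisenberg.CharacteristicLift :=
  CharacteristicLift_of stub_charZeroDescent stub_henselLift

end Summit.MatrixMultiplication.MatrixMultiplication.Cruxes.CharacteristicLift.Birth

end
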